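/-
Copyright: statement-level skeleton of a published paper (lit-balaban cell, Phase-2 proof seat p10, gen 2). No proof claims
beyond what the kernel checks below.
-/
import Literature.MathematicalPhysics.QuantumFieldTheory.Balaban1983to89.B2Eq228Conditioning

/-!
# `BalabanImbrieJaffe1984to88.BIJ88Conditioning512` — T. Bałaban, J. Imbrie, A. Jaffe, *Effective action and cluster
properties of the abelian Higgs model*, Commun. Math. Phys. **114** (1988) 257–315 [BalabanImbrieJaffe1988]: Sect. 5.12
*Conditional Integration*, the conditioning identity for scalar fields printed on p. 300 — PROVED as a theorem about
Lebesgue integrals on the finite-dimensional Gaussian model the print describes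

statement-level skeleton of published theorems with citation tags; proofs where landed; nothing here is a claim about
the Yang–Mills mass gap

PDF held: `paper:balaban1988-cmp114-bij-abelian-higgs-effective-action` (journal page = PDF page + 256).  Renders read as
images: PDF pp. 44–46 (journal 300–302), poppler renders in the seat folder (`renders/c2pages/c2-p044…p046.png`).

CITATION HEADER (lean-in-tree rule).  Part of the lit-balaban TYPED SKELETON (HOME `run/shared/lean/pub/lit-balaban/`); WHAT IS
REPRODUCED: the INTEGRAL FORM of the unnumbered display of p. 300 opening Sect. 5.12, i.e. the provable kernel of SKELETON row
**C2.Eq5.12.1-5.12.7** (`HOME/lit-balaban-r16/ROWS-C2-part2.md`, reader/fold owner r16; this file is COMPLEMENTARY to r16's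
`BIJ88Sect5StatementsPart4.completeSquare300`, the algebraic completing-the-square core, whose docstring records that *"the
Gaussian integrals themselves and (5.12.1)–(5.12.8) are not typed"*).  (5.12.1)–(5.12.7) proper (the model-specific exterior
Gaussian, interior integral and translations) are NOT typed here.

THE PRINTED TEXT (p. 300 [PDF 44] – p. 302 [PDF 46], verbatim).  *"5.12. Conditional Integration.  We exploit the simple
structure in Λ₁₀^{(k)} by doing the integrals there with conditioning on Λ₁₀^{(k)c}, Λ₁₀^{(k)c*c}.  The formula we use is a
generalization of the following identity for scalar fields:
  ∫dφ|_{Λᶜ} F(φ|_{Λᶜ}) ∫dφ|_Λ e^{−⟨Λᶜφ, ΔΛφ⟩} e^{−1/2⟨φ, Δ_Λφ⟩} G(φ)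
    = ∫dφ|_{Λᶜ} F(φ|_{Λᶜ}) ∫dφ|_Λ e^{−⟨Λᶜφ, ΔΛφ⟩} e^{−1/2⟨φΔ_Λφ⟩}
        × ∫dφ|_Λ G(φ) e^{−1/2⟨φ, Δ_Λφ⟩} e^{−⟨Λᶜφ, ΔΛφ⟩} / ∫dφ|_Λ e^{−1/2⟨φ, Δ_Λφ⟩} e^{−⟨Λᶜ, ΔΛφ⟩}
    = (∫dφ|_Λ e^{−1/2⟨φ, Δ_Λφ⟩}) ∫dφ|_{Λᶜ} F(φ|_{Λᶜ}) e^{1/2⟨Λᶜφ, ΔΛΔ_Λ⁻¹ΛΔΛᶜφ⟩}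
        × (1/𝒩) ∫dφ|_Λ G(φ) e^{−1/2⟨φ, Δ_Λφ⟩} e^{−⟨Λᶜφ, ΔΛφ⟩}.
Here 𝒩 is equal to the last integral, without G(φ)."*  And p. 302: *"Here dμ^{(k)}_{Λ₁₀^{(k)}} is an uncentered, normalized
Gaussian measure, … This measure has covariances C^{(k)}_{Λ₁₀^{(k)c*c}}, C^{(k)}_{Λ₁₀^{(k)}}(u_{k+1}), and nonzero means reflecting
the terms linear in Λ₁₀^{(k)}φ^{(k)″} or Λ₁₀^{(k)c*c}A^{(k)″}."*

THE MODEL (finite-dimensional, exactly the printed generality; the vocabulary is that of the tree's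
`Balaban1983to89.B2Eq228Conditioning` = [Balaban1982Higgs2] (2.28), which IS the "conditional integration with conditioning on
Λᶜ" of Bałaban's earlier papers).  The lattice ↦ a finite type `S`; `Λ` ↦ a decidable predicate `p` (points of `Λ` = `In p`,
of `Λᶜ` = `Out p`); `φ|_Λ = x : In p → ℝ`, `φ|_{Λᶜ} = y : Out p → ℝ`, `φ = glue p x y`; `dφ|_Λ`, `dφ|_{Λᶜ}` = Lebesgue `volume`;
the inverse covariance `Δ : Matrix S S ℝ`, SYMMETRIC, with `Δ_Λ = blkIn p Δ` POSITIVE DEFINITE (nothing is assumed about the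
other blocks); `⟨Λᶜφ, ΔΛφ⟩ = y ⬝ᵥ (blkMix' p Δ *ᵥ x)` (the `Λᶜ × Λ` block), `ΛΔΛᶜφ = blkMix p Δ *ᵥ y =: J(y)`; `F : (Out p → ℝ) → ℝ`
and `G : (S → ℝ) → ℝ` ARBITRARY (no measurability or integrability is needed for the printed iterated-integral identity: at
each exterior field `y` the two inner integrands agree after multiplying and dividing by `𝒩(y) ≠ 0`, and `𝒩(y)` itself
converges).

WHAT IS KERNEL-CHECKED (zero `sorry`, standard axioms).
 * `calN_eq` — **"𝒩"** evaluated: `𝒩(y) = ∫dx e^{−½⟨x,Δ_Λx⟩}e^{−⟨y, Δ_{ΛᶜΛ}x⟩} = e^{½⟨J(y), Δ_Λ⁻¹J(y)⟩} ∫dx e^{−½⟨x,Δ_Λx⟩}`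
   (translation invariance of `dx`: the tree's `B2Eq228Conditioning.integral_tilt` = `B13GaugeDevices.integral_linear_shift`),
   `calN_pos`, and `exponent_eq_printed`: `⟨J, Δ_Λ⁻¹J⟩` IS the printed `⟨Λᶜφ, ΔΛΔ_Λ⁻¹ΛΔΛᶜφ⟩`;
 * `display300_eq1` — the FIRST printed equality (multiply and divide by `𝒩(φ|_{Λᶜ})`);
 * `display300` — the SECOND printed equality = the whole display, for every `F`, `G`;
 * `normalized_eq_gaussProb` — p. 302's reading of the last factor: `𝒩⁻¹∫dφ|_Λ G(φ)e^{−½⟨φ,Δ_Λφ⟩}e^{−⟨Λᶜφ,ΔΛφ⟩}` is the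
   expectation of `G((· − Δ_Λ⁻¹J(y)) on Λ, y on Λᶜ)` under the normalized Gaussian measure `gaussProb (blkIn p Δ)` of covariance
   `Δ_Λ⁻¹` — an uncentered (mean `−Δ_Λ⁻¹ΛΔΛᶜφ`), normalized Gaussian measure;
 * `display300_joint` — the same identity with the left side written as ONE integral over all `φ : S → ℝ` (Fubini; here the
   joint integrand must be integrable).
NOT reproduced: (5.12.1)–(5.12.8) (the Landau-gauge exterior Gaussian, the interior integral, the translations (5.12.4)/(5.12.6)
and the measure (5.12.7) of the abelian Higgs model run), which live over the Sect. 5 carriers of `BIJ88Sect5Statements*`.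
Unit `lit-balaban-p10` (gen 2), HOME as above.
-/

open MeasureTheory Matrix Finset
open scoped BigOperators

namespace Literature.MathematicalPhysics.QuantumFieldTheory.BalabanImbrieJaffe1984to88.BIJ88Conditioning512

open Balaban1983to89.B2Eq228Conditioning
open Balaban1983to89.B13GaugeDevices (gaussWeight gaussInt gaussNorm gaussMean)

noncomputable section

variable {S : Type} [Fintype S] (p : S → Prop) [DecidablePred p] (Δ : Matrix S S ℝ)

/-! ## §1 The integrands of the display -/

/-- `e^{−½⟨φ, Δ_Λφ⟩}` as a function of `x = φ|_Λ` (`Δ_Λ = blkIn p Δ`). [cite: BalabanImbrieJaffe1988, (5.12.1) p.300] -/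
def wIn (x : In p → ℝ) : ℝ := Real.exp (-(1 / 2 : ℝ) * (x ⬝ᵥ (blkIn p Δ *ᵥ x)))

/-- `e^{−⟨Λᶜφ, ΔΛφ⟩}` as a function of `(x, y) = (φ|_Λ, φ|_{Λᶜ})`. [cite: BalabanImbrieJaffe1988, (5.12.1) p.300] -/
def cpl (x : In p → ℝ) (y : Out p → ℝ) : ℝ := Real.exp (-(y ⬝ᵥ (blkMix' p Δ *ᵥ x)))

/-- `J(φ|_{Λᶜ}) := ΛΔΛᶜφ`, the source the exterior field induces on `Λ`. [cite: BalabanImbrieJaffe1988, (5.12.1) p.300] -/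
def srcJ (y : Out p → ℝ) : In p → ℝ := blkMix p Δ *ᵥ y

/-- *"the last integral"* `∫dφ|_Λ G(φ) e^{−½⟨φ,Δ_Λφ⟩} e^{−⟨Λᶜφ,ΔΛφ⟩}` as a function of the exterior field `y = φ|_{Λᶜ}`.
[cite: BalabanImbrieJaffe1988, (5.12.1) p.300] -/
def lastInt (G : (S → ℝ) → ℝ) (y : Out p → ℝ) : ℝ := ∫ x, G (glue p x y) * (wIn p Δ x * cpl p Δ x y)

/-- **𝒩**: *"Here 𝒩 is equal to the last integral, without G(φ)"* — `𝒩(y) = ∫dφ|_Λ e^{−½⟨φ,Δ_Λφ⟩}e^{−⟨Λᶜφ,ΔΛφ⟩}`.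
[cite: BalabanImbrieJaffe1988, (5.12.1) p.300] -/
def calN (y : Out p → ℝ) : ℝ := ∫ x, wIn p Δ x * cpl p Δ x y

/-- `𝒩` is the last integral with `G = 1`. [cite: BalabanImbrieJaffe1988, (5.12.1) p.300] -/
theorem calN_eq_lastInt_one (y : Out p → ℝ) : calN p Δ y = lastInt p Δ (fun _ => 1) y := by
  simp [calN, lastInt]

/-! ## §2 Algebra of the exponent -/

/-- For symmetric `Δ`: `⟨Λᶜφ, ΔΛφ⟩ = ⟨ΛΔΛᶜφ, Λφ⟩ = ⟨J(y), x⟩`. [folklore] [cite: BalabanImbrieJaffe1988, (5.12.1) p.300] -/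
theorem mix_dot_eq (hΔ : Δ.IsSymm) (x : In p → ℝ) (y : Out p → ℝ) :
    y ⬝ᵥ (blkMix' p Δ *ᵥ x) = srcJ p Δ y ⬝ᵥ x := by
  rw [blkMix'_eq_transpose p hΔ, mulVec_transpose, dotProduct_comm, ← dotProduct_mulVec, dotProduct_comm, srcJ]

/-- The coupling factor as `e^{−⟨J(y), x⟩}`. [folklore] [cite: BalabanImbrieJaffe1988, (5.12.1) p.300] -/
theorem cpl_eq (hΔ : Δ.IsSymm) (x : In p → ℝ) (y : Out p → ℝ) :
    cpl p Δ x y = Real.exp (-(srcJ p Δ y ⬝ᵥ x)) := by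
  rw [cpl, mix_dot_eq p Δ hΔ]

/-- The interior weight times the coupling is the tilted Gaussian weight `e^{−⟨J,x⟩ − ½⟨x,Δ_Λx⟩}` of
`B2Eq228Conditioning.integral_tilt`. [folklore] [cite: BalabanImbrieJaffe1988, (5.12.1) p.300] -/
theorem wIn_mul_cpl (hΔ : Δ.IsSymm) (x : In p → ℝ) (y : Out p → ℝ) :
    wIn p Δ x * cpl p Δ x y = Real.exp (-(srcJ p Δ y ⬝ᵥ x) - 1 / 2 * (x ⬝ᵥ (blkIn p Δ *ᵥ x))) := by
  rw [cpl_eq p Δ hΔ, wIn, ← Real.exp_add]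
  congr 1
  ring

omit [Fintype S] [DecidablePred p] in
/-- `Δ_Λ` inherits symmetry. [folklore] [cite: BalabanImbrieJaffe1988, (5.12.1) p.300] -/
theorem blkIn_isSymm (hΔ : Δ.IsSymm) : (blkIn p Δ).IsSymm := by
  ext i j
  simp only [blkIn, submatrix_apply, transpose_apply]
  exact hΔ.apply i.1 j.1

/-! ## §3 `𝒩` and the last integral, evaluated by the linear shift -/

section Eval

variable [DecidableEq S]

/-- The exponent `⟨J(y), Δ_Λ⁻¹J(y)⟩` IS the printed `⟨Λᶜφ, ΔΛΔ_Λ⁻¹ΛΔΛᶜφ⟩` (symmetric `Δ`).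
[cite: BalabanImbrieJaffe1988, (5.12.1) p.300] -/
theorem exponent_eq_printed (hΔ : Δ.IsSymm) (y : Out p → ℝ) :
    srcJ p Δ y ⬝ᵥ ((blkIn p Δ)⁻¹ *ᵥ srcJ p Δ y)
      = y ⬝ᵥ (blkMix' p Δ *ᵥ ((blkIn p Δ)⁻¹ *ᵥ (blkMix p Δ *ᵥ y))) := by
  rw [mix_dot_eq p Δ hΔ, srcJ]

/-- **The last integral, shifted**: `∫dφ|_Λ G(φ)e^{−½⟨φ,Δ_Λφ⟩}e^{−⟨Λᶜφ,ΔΛφ⟩} = e^{½⟨J,Δ_Λ⁻¹J⟩}∫dz e^{−½⟨z,Δ_Λz⟩}G((z − Δ_Λ⁻¹J) on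
Λ, y on Λᶜ)` — no hypothesis on `G` (translation invariance of `dφ|_Λ`). [cite: BalabanImbrieJaffe1988, (5.12.1) p.300] -/
theorem lastInt_eq (hΔ : Δ.IsSymm) (hΛ : (blkIn p Δ).PosDef) (G : (S → ℝ) → ℝ) (y : Out p → ℝ) :
    lastInt p Δ G y = Real.exp (1 / 2 * (srcJ p Δ y ⬝ᵥ ((blkIn p Δ)⁻¹ *ᵥ srcJ p Δ y)))
      * gaussInt (blkIn p Δ) (fun z => G (glue p (z - (blkIn p Δ)⁻¹ *ᵥ srcJ p Δ y) y)) := by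
  have hdet : IsUnit (blkIn p Δ).det := isUnit_iff_ne_zero.2 hΛ.det_pos.ne'
  have hpt : ∀ x, G (glue p x y) * (wIn p Δ x * cpl p Δ x y)
      = Real.exp (-(srcJ p Δ y ⬝ᵥ x) - 1 / 2 * (x ⬝ᵥ (blkIn p Δ *ᵥ x))) * G (glue p x y) := by
    intro x
    rw [wIn_mul_cpl p Δ hΔ]
    ring
  unfold lastInt
  simp_rw [hpt]
  exact integral_tilt (blkIn p Δ) (blkIn_isSymm p Δ hΔ) hdet (srcJ p Δ y) (fun x => G (glue p x y))

/-- **𝒩 evaluated**: `𝒩(y) = e^{½⟨J(y), Δ_Λ⁻¹J(y)⟩} · ∫dφ|_Λ e^{−½⟨φ,Δ_Λφ⟩}` — the source of the factors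
`(∫dφ|_Λe^{−½⟨φ,Δ_Λφ⟩})` and `e^{½⟨Λᶜφ,ΔΛΔ_Λ⁻¹ΛΔΛᶜφ⟩}` of the display. [cite: BalabanImbrieJaffe1988, (5.12.1) p.300] -/
theorem calN_eq (hΔ : Δ.IsSymm) (hΛ : (blkIn p Δ).PosDef) (y : Out p → ℝ) :
    calN p Δ y = gaussNorm (blkIn p Δ) * Real.exp (1 / 2 * (srcJ p Δ y ⬝ᵥ ((blkIn p Δ)⁻¹ *ᵥ srcJ p Δ y))) := by
  have h1 : gaussInt (blkIn p Δ) (fun _ : In p → ℝ => (1 : ℝ)) = gaussNorm (blkIn p Δ) := by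
    simp [gaussInt, gaussNorm]
  rw [calN_eq_lastInt_one, lastInt_eq p Δ hΔ hΛ, h1, mul_comm]

omit [DecidableEq S] in
/-- `𝒩(y) > 0` (here only `Δ_Λ` positive definite is used). [cite: BalabanImbrieJaffe1988, (5.12.1) p.300] -/
theorem calN_pos (hΛ : (blkIn p Δ).PosDef) (y : Out p → ℝ) : 0 < calN p Δ y := by
  classical
  have hpt : ∀ x, wIn p Δ x * cpl p Δ x y
      = Real.exp (-((y ᵥ* blkMix' p Δ) ⬝ᵥ x) - 1 / 2 * (x ⬝ᵥ (blkIn p Δ *ᵥ x))) := by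
    intro x
    rw [wIn, cpl, ← Real.exp_add, ← dotProduct_mulVec y (blkMix' p Δ) x]
    congr 1
    ring
  unfold calN
  simp_rw [hpt]
  exact integral_exp_pos (integrable_tilt hΛ _)

/-- **p. 302**, *"an uncentered, normalized Gaussian measure … covariances C … and nonzero means reflecting the terms linear in
…"*: the normalized last factor `𝒩⁻¹∫dφ|_Λ G(φ)e^{−½⟨φ,Δ_Λφ⟩}e^{−⟨Λᶜφ,ΔΛφ⟩}` is the expectation of `G` in the interior field under
the probability Gaussian measure of covariance `Δ_Λ⁻¹` (`B2Eq228Conditioning.gaussProb (blkIn p Δ)`) translated by the mean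
`−Δ_Λ⁻¹ΛΔΛᶜφ`, the exterior field held fixed. [cite: BalabanImbrieJaffe1988, (5.12.7) p.302] -/
theorem normalized_eq_gaussProb (hΔ : Δ.IsSymm) (hΛ : (blkIn p Δ).PosDef) (G : (S → ℝ) → ℝ) (y : Out p → ℝ) :
    (calN p Δ y)⁻¹ * lastInt p Δ G y
      = ∫ z, G (glue p (z - (blkIn p Δ)⁻¹ *ᵥ srcJ p Δ y) y) ∂(gaussProb (blkIn p Δ)) := by
  have hN : gaussNorm (blkIn p Δ) ≠ 0 := (gaussNorm_pos hΛ).ne'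
  have hE : Real.exp (1 / 2 * (srcJ p Δ y ⬝ᵥ ((blkIn p Δ)⁻¹ *ᵥ srcJ p Δ y))) ≠ 0 := (Real.exp_pos _).ne'
  rw [integral_gaussProb_eq, calN_eq p Δ hΔ hΛ, lastInt_eq p Δ hΔ hΛ]
  simp only [gaussInt, smul_eq_mul]
  rw [mul_inv, mul_assoc, inv_mul_cancel_left₀ hE]

end Eval

/-! ## §4 The display of p. 300 -/

section Display

variable [DecidableEq S]

omit [DecidableEq S] in
/-- **p. 300, first equality** (multiply and divide by `𝒩(φ|_{Λᶜ})`, which is positive): for every `F`, `G`,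
`∫dφ|_{Λᶜ}F ∫dφ|_Λ e^{−⟨Λᶜφ,ΔΛφ⟩}e^{−½⟨φ,Δ_Λφ⟩}G = ∫dφ|_{Λᶜ}F · ∫dφ|_Λ e^{−⟨Λᶜφ,ΔΛφ⟩}e^{−½⟨φ,Δ_Λφ⟩} ·
(∫dφ|_Λ G e^{−½⟨φ,Δ_Λφ⟩}e^{−⟨Λᶜφ,ΔΛφ⟩}) / (∫dφ|_Λ e^{−½⟨φ,Δ_Λφ⟩}e^{−⟨Λᶜφ,ΔΛφ⟩})`. [cite: BalabanImbrieJaffe1988, (5.12.1) p.300] -/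
theorem display300_eq1 (hΛ : (blkIn p Δ).PosDef) (F : (Out p → ℝ) → ℝ) (G : (S → ℝ) → ℝ) :
    ∫ y, F y * ∫ x, cpl p Δ x y * wIn p Δ x * G (glue p x y)
      = ∫ y, F y * ((∫ x, cpl p Δ x y * wIn p Δ x) * (lastInt p Δ G y / calN p Δ y)) := by
  refine integral_congr_ae (Filter.Eventually.of_forall fun y => ?_)
  have hN : calN p Δ y ≠ 0 := (calN_pos p Δ hΛ y).ne'
  have h1 : (∫ x, cpl p Δ x y * wIn p Δ x * G (glue p x y)) = lastInt p Δ G y := by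
    unfold lastInt
    refine integral_congr_ae (Filter.Eventually.of_forall fun x => ?_)
    show cpl p Δ x y * wIn p Δ x * G (glue p x y) = G (glue p x y) * (wIn p Δ x * cpl p Δ x y)
    ring
  have h2 : (∫ x, cpl p Δ x y * wIn p Δ x) = calN p Δ y := by
    unfold calN
    refine integral_congr_ae (Filter.Eventually.of_forall fun x => ?_)
    show cpl p Δ x y * wIn p Δ x = wIn p Δ x * cpl p Δ x y
    ring
  show F y * (∫ x, cpl p Δ x y * wIn p Δ x * G (glue p x y))
    = F y * ((∫ x, cpl p Δ x y * wIn p Δ x) * (lastInt p Δ G y / calN p Δ y))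
  rw [h1, h2, mul_div_cancel₀ _ hN]

/-- **p. 300, the conditioning identity** (both printed equalities; `Δ` symmetric, `Δ_Λ` positive definite, `F`, `G` arbitrary):
`∫dφ|_{Λᶜ} F(φ|_{Λᶜ}) ∫dφ|_Λ e^{−⟨Λᶜφ,ΔΛφ⟩}e^{−½⟨φ,Δ_Λφ⟩}G(φ)
  = (∫dφ|_Λ e^{−½⟨φ,Δ_Λφ⟩}) ∫dφ|_{Λᶜ} F(φ|_{Λᶜ}) e^{½⟨Λᶜφ,ΔΛΔ_Λ⁻¹ΛΔΛᶜφ⟩} · 𝒩⁻¹∫dφ|_Λ G(φ)e^{−½⟨φ,Δ_Λφ⟩}e^{−⟨Λᶜφ,ΔΛφ⟩}`,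
`𝒩 = 𝒩(φ|_{Λᶜ})` the last integral without `G`. [cite: BalabanImbrieJaffe1988, (5.12.1) p.300] -/
theorem display300 (hΔ : Δ.IsSymm) (hΛ : (blkIn p Δ).PosDef) (F : (Out p → ℝ) → ℝ) (G : (S → ℝ) → ℝ) :
    ∫ y, F y * ∫ x, cpl p Δ x y * wIn p Δ x * G (glue p x y)
      = gaussNorm (blkIn p Δ)
        * ∫ y, F y * Real.exp (1 / 2 * (y ⬝ᵥ (blkMix' p Δ *ᵥ ((blkIn p Δ)⁻¹ *ᵥ (blkMix p Δ *ᵥ y)))))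
            * ((calN p Δ y)⁻¹ * lastInt p Δ G y) := by
  rw [← integral_const_mul]
  refine integral_congr_ae (Filter.Eventually.of_forall fun y => ?_)
  have hg : gaussNorm (blkIn p Δ) ≠ 0 := (gaussNorm_pos hΛ).ne'
  have he : Real.exp (1 / 2 * (srcJ p Δ y ⬝ᵥ ((blkIn p Δ)⁻¹ *ᵥ srcJ p Δ y))) ≠ 0 := (Real.exp_pos _).ne'
  have h1 : (∫ x, cpl p Δ x y * wIn p Δ x * G (glue p x y)) = lastInt p Δ G y := by
    unfold lastInt
    refine integral_congr_ae (Filter.Eventually.of_forall fun x => ?_)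
    show cpl p Δ x y * wIn p Δ x * G (glue p x y) = G (glue p x y) * (wIn p Δ x * cpl p Δ x y)
    ring
  show F y * (∫ x, cpl p Δ x y * wIn p Δ x * G (glue p x y))
    = gaussNorm (blkIn p Δ) * (F y * Real.exp (1 / 2 * (y ⬝ᵥ (blkMix' p Δ *ᵥ ((blkIn p Δ)⁻¹ *ᵥ (blkMix p Δ *ᵥ y)))))
        * ((calN p Δ y)⁻¹ * lastInt p Δ G y))
  rw [h1, ← exponent_eq_printed p Δ hΔ, calN_eq p Δ hΔ hΛ y, mul_inv]
  rw [show gaussNorm (blkIn p Δ) * (F y * Real.exp (1 / 2 * (srcJ p Δ y ⬝ᵥ ((blkIn p Δ)⁻¹ *ᵥ srcJ p Δ y)))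
      * ((gaussNorm (blkIn p Δ))⁻¹ * (Real.exp (1 / 2 * (srcJ p Δ y ⬝ᵥ ((blkIn p Δ)⁻¹ *ᵥ srcJ p Δ y))))⁻¹
        * lastInt p Δ G y))
      = (gaussNorm (blkIn p Δ) * (gaussNorm (blkIn p Δ))⁻¹)
        * (Real.exp (1 / 2 * (srcJ p Δ y ⬝ᵥ ((blkIn p Δ)⁻¹ *ᵥ srcJ p Δ y)))
            * (Real.exp (1 / 2 * (srcJ p Δ y ⬝ᵥ ((blkIn p Δ)⁻¹ *ᵥ srcJ p Δ y))))⁻¹)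
        * (F y * lastInt p Δ G y) by ring,
    mul_inv_cancel₀ hg, mul_inv_cancel₀ he, one_mul, one_mul]

/-- **p. 300 with p. 302**: the same identity with the last factor written as the expectation under the uncentered normalized
Gaussian measure (`normalized_eq_gaussProb`). [cite: BalabanImbrieJaffe1988, (5.12.7) p.302] -/
theorem display300_gaussProb (hΔ : Δ.IsSymm) (hΛ : (blkIn p Δ).PosDef) (F : (Out p → ℝ) → ℝ) (G : (S → ℝ) → ℝ) :
    ∫ y, F y * ∫ x, cpl p Δ x y * wIn p Δ x * G (glue p x y)
      = gaussNorm (blkIn p Δ)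
        * ∫ y, F y * Real.exp (1 / 2 * (y ⬝ᵥ (blkMix' p Δ *ᵥ ((blkIn p Δ)⁻¹ *ᵥ (blkMix p Δ *ᵥ y)))))
            * ∫ z, G (glue p (z - (blkIn p Δ)⁻¹ *ᵥ srcJ p Δ y) y) ∂(gaussProb (blkIn p Δ)) := by
  rw [display300 p Δ hΔ hΛ]
  congr 1
  refine integral_congr_ae (Filter.Eventually.of_forall fun y => ?_)
  show F y * Real.exp (1 / 2 * (y ⬝ᵥ (blkMix' p Δ *ᵥ ((blkIn p Δ)⁻¹ *ᵥ (blkMix p Δ *ᵥ y)))))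
        * ((calN p Δ y)⁻¹ * lastInt p Δ G y)
    = F y * Real.exp (1 / 2 * (y ⬝ᵥ (blkMix' p Δ *ᵥ ((blkIn p Δ)⁻¹ *ᵥ (blkMix p Δ *ᵥ y)))))
        * ∫ z, G (glue p (z - (blkIn p Δ)⁻¹ *ᵥ srcJ p Δ y) y) ∂(gaussProb (blkIn p Δ))
  rw [normalized_eq_gaussProb p Δ hΔ hΛ]

/-- **p. 300, joint form**: when `F(φ|_{Λᶜ})e^{−⟨Λᶜφ,ΔΛφ⟩}e^{−½⟨φ,Δ_Λφ⟩}G(φ)` is integrable over all `φ : S → ℝ` (`dφ =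
dφ|_Λ dφ|_{Λᶜ}`), the left side may be written as one integral `∫dφ F(φ|_{Λᶜ})e^{−⟨Λᶜφ,ΔΛφ⟩}e^{−½⟨φ,Δ_Λφ⟩}G(φ)` (Fubini), and the
conditioning identity reads the same. [cite: BalabanImbrieJaffe1988, (5.12.1) p.300] -/
theorem display300_joint (hΔ : Δ.IsSymm) (hΛ : (blkIn p Δ).PosDef) (F : (Out p → ℝ) → ℝ) (G : (S → ℝ) → ℝ)
    (hint : Integrable fun φ : S → ℝ => F (resOut p φ) * (cpl p Δ (resIn p φ) (resOut p φ) * wIn p Δ (resIn p φ) * G φ)) :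
    ∫ φ : S → ℝ, F (resOut p φ) * (cpl p Δ (resIn p φ) (resOut p φ) * wIn p Δ (resIn p φ) * G φ)
      = gaussNorm (blkIn p Δ)
        * ∫ y, F y * Real.exp (1 / 2 * (y ⬝ᵥ (blkMix' p Δ *ᵥ ((blkIn p Δ)⁻¹ *ᵥ (blkMix p Δ *ᵥ y)))))
            * ((calN p Δ y)⁻¹ * lastInt p Δ G y) := by
  rw [← display300 p Δ hΔ hΛ F G]
  set Φ : (In p → ℝ) × (Out p → ℝ) → ℝ :=
    fun q => F q.2 * (cpl p Δ q.1 q.2 * wIn p Δ q.1 * G (glue p q.1 q.2)) with hΦdef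
  have eL : (∫ φ : S → ℝ, F (resOut p φ) * (cpl p Δ (resIn p φ) (resOut p φ) * wIn p Δ (resIn p φ) * G φ)) = ∫ q, Φ q := by
    rw [integral_eq_integral_glue p]
    simp only [hΦdef, resIn_glue, resOut_glue]
  have hΦ : Integrable Φ := by
    have h := (integrable_iff_integrable_glue p _).1 hint
    simpa only [hΦdef, resIn_glue, resOut_glue] using h
  have hFub : (∫ q, Φ q) = ∫ y, ∫ x, Φ (x, y) := integral_prod_symm Φ hΦ
  rw [eL, hFub]
  refine integral_congr_ae (Filter.Eventually.of_forall fun y => ?_)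
  show (∫ x, Φ (x, y)) = F y * ∫ x, cpl p Δ x y * wIn p Δ x * G (glue p x y)
  simp only [hΦdef]
  rw [integral_const_mul]

end Display

end

end Literature.MathematicalPhysics.QuantumFieldTheory.BalabanImbrieJaffe1984to88.BIJ88Conditioning512
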